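import Mathlib
import HarnessLib
import Summits.HubbardSuperconductivity.HubbardSuperconductivity.Theorems.KLProgrammeKLRegimeSectorSliceDefectRowsFat

/-!
# Route `KLProgramme` — VL child `KLRegimeVolumeLimitV17F2` (stmt-HubbardSuperconductivity-20440), closer MODEL file M2 «MISMATCH-SLICE», brackets (a)(b),
# RATE FORM, part 1a (pure real algebra): the pieces of the closed amplitude of `…SectorSliceDefectRowsFat` at the canonical rates

Cell `gate-hubbard-kl`, seat hubbard-kl-k3c4-p2 (g13; UV / Matsubara all-U lane); WANT (w7) of the VL registrant k3c4-p1 g12 (KL STATUS 2026-08-28 00:32Z):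
the `sE/cR/cC` of the sectorised slice-covariance frame defect in the `∃C`-before-`(L, M, K, K′, ε)` shape of `…SectorOverlapDefectRate` (p587829).
`rowSum_/colSum_sliceCT_sub_bgmFat_le` (p580272) bound the plain rows / columns of `S(F̃[K])ᵀ·(C^{K′}_{(Λ,Λ′]} − C^{K}_{(Λ,Λ′]})·S(F̃[K])` by
`8·9·D·√W(s)·√(24·2M·L²·N̄_L)·A^Δ` with free rates `s₀ … s₃′`, tangent resolution `Nr`, far radius `R₀` and the closed amplitude `A^Δ` (equations
`hX₀ … hX₃`, `hTt`, `hAe1 … hAv2`, `hAΔ`).  This file fixes `s₀ := 1/(2M)`, `s₁ = s₂ = s₃ = s₃′ := 1`, `Nr := 2`, `R₀ := 0`, the increment sizes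
`P₀ = P₁ = P₂ = P₃ := ε ∈ [0, 1]`, and proves — over ABSTRACT atoms, so that `ring`/`field_simp` stay small — that the whole bound is
`≤ Q·((2M+1)/β)·ε` with `Q` free of `(L, M, ε)` and of the frames:

* §1 `incrX₁_le` … `incrX₃_le`, `incrTt_eq` — the increment polynomials are `≤ ε ×` their value at `P ≡ 1` (`ε ≤ 1`);
* §2 `rateBlock3_eq`, `rateBlock2_eq` — the `L`-cancellation `ℓ^k·X / (4/(sL))^k` of the four spatial rate blocks (`ℓ = c/L`);
* §3 `rateAmp1_mul_le`, `rateAmp2_mul_le` — `L·A₁ ≤ a₁`, `L²·A₂ ≤ a₂` for the direction amplitudes `Ae/An/Av` (every term carries `ℓ` resp. `ℓ²`);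
* §4 `sliceDefect_count_le` — `√W(1/(2M)) · √(24·2M·L²·N̄_L) ≤ (2M+1)·L²·√(24·W₁·N₁)`.
Part 1b (`…SectorSliceDefectRateCore`) packages them into `sliceDefect_rate_core` (`∃ Q ≥ 0` free of `(L, M, ε)` and of the frames); part 2
(`…SectorSliceDefectRate`) feeds p580272 through the core.  Proofs only; no definitions. [folklore] BGM 2006 §2.8 (2.81), §3 (3.3).
-/

noncomputable section

namespace Summit.HubbardSuperconductivity.HubbardSuperconductivity.Theorems.TorusFourierL2

set_option linter.dupNamespace false -- summit = problem name (single-conjunct summit), D-0017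

open scoped Real

/-! ## §1 The increment polynomials at `P ≡ ε ≤ 1` -/

/-- `X₁(ε) ≤ ε·X₁(1)` for `0 ≤ ε ≤ 1` (nonnegative coefficients). [folklore] -/
theorem incrX₁_le {c₀ c₁ K₁ ε X₁ : ℝ} (hc₁ : 0 ≤ c₁) (hε : 0 ≤ ε) (hε1 : ε ≤ 1)
    (hX₁ : X₁ = c₁ * ε * (K₁ + ε) + c₀ * ε) : X₁ ≤ ε * (c₁ * (K₁ + 1) + c₀) := by
  rw [hX₁]
  have : ε * (c₁ * (K₁ + 1) + c₀) = c₁ * ε * (K₁ + 1) + c₀ * ε := by ring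
  rw [this]
  gcongr

/-- `X₂(ε) ≤ ε·X₂(1)` for `0 ≤ ε ≤ 1`. [folklore] -/
theorem incrX₂_le {c₀ c₁ c₂ K₁ K₂ ε X₂ : ℝ} (hc₁ : 0 ≤ c₁) (hc₂ : 0 ≤ c₂) (hK₁ : 0 ≤ K₁) (hε : 0 ≤ ε)
    (hε1 : ε ≤ 1) (hX₂ : X₂ = c₂ * ε * (K₁ + ε) ^ 2 + c₁ * (ε * (2 * K₁ + ε)) + (c₁ * ε * (K₂ + ε) + c₀ * ε)) :
    X₂ ≤ ε * (c₂ * (K₁ + 1) ^ 2 + c₁ * (2 * K₁ + 1) + (c₁ * (K₂ + 1) + c₀)) := by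
  rw [hX₂]
  have : ε * (c₂ * (K₁ + 1) ^ 2 + c₁ * (2 * K₁ + 1) + (c₁ * (K₂ + 1) + c₀)) =
      c₂ * ε * (K₁ + 1) ^ 2 + c₁ * (ε * (2 * K₁ + 1)) + (c₁ * ε * (K₂ + 1) + c₀ * ε) := by ring
  rw [this]
  gcongr

/-- `X₃(ε) ≤ ε·X₃(1)` for `0 ≤ ε ≤ 1`. [folklore] -/
theorem incrX₃_le {c₀ c₁ c₂ c₃ K₁ K₂ K₃ ε X₃ : ℝ} (hc₁ : 0 ≤ c₁) (hc₂ : 0 ≤ c₂) (hc₃ : 0 ≤ c₃) (hK₁ : 0 ≤ K₁)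
    (hK₂ : 0 ≤ K₂) (hε : 0 ≤ ε) (hε1 : ε ≤ 1)
    (hX₃ : X₃ = c₃ * ε * (K₁ + ε) ^ 3 + c₂ * (ε * (3 * K₁ ^ 2 + 3 * K₁ * ε + ε ^ 2)) +
      3 * (c₂ * ε * ((K₁ + ε) * (K₂ + ε)) + c₁ * (K₁ * ε + ε * K₂ + ε * ε)) + (c₁ * ε * (K₃ + ε) + c₀ * ε)) :
    X₃ ≤ ε * (c₃ * (K₁ + 1) ^ 3 + c₂ * (3 * K₁ ^ 2 + 3 * K₁ + 1) + 3 * (c₂ * ((K₁ + 1) * (K₂ + 1)) + c₁ * (K₁ + K₂ + 1)) +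
      (c₁ * (K₃ + 1) + c₀)) := by
  rw [hX₃]
  have e : ε * (c₃ * (K₁ + 1) ^ 3 + c₂ * (3 * K₁ ^ 2 + 3 * K₁ + 1) + 3 * (c₂ * ((K₁ + 1) * (K₂ + 1)) + c₁ * (K₁ + K₂ + 1)) +
      (c₁ * (K₃ + 1) + c₀)) = c₃ * ε * (K₁ + 1) ^ 3 + c₂ * (ε * (3 * K₁ ^ 2 + 3 * K₁ * 1 + 1 ^ 2)) +
      3 * (c₂ * ε * ((K₁ + 1) * (K₂ + 1)) + c₁ * (K₁ * ε + ε * K₂ + ε * 1)) + (c₁ * ε * (K₃ + 1) + c₀ * ε) := by ring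
  rw [e]
  gcongr

/-! ## §2 The `L`-cancellation of the spatial rate blocks -/

/-- **Cubic rate block**: with `ℓ = c/L`, `((√2ℓ)³X₃ + 3(A₁((√2ℓ)²X₂)) + 3(A₂((√2ℓ)X₁)) + κℓ³/Λ³X₀)/(4/(sL))³ =
s³·((√2c)³X₃ + 3((L·A₁)((√2c)²X₂)) + 3((L²·A₂)((√2c)X₁)) + κc³/Λ³X₀)/64`. [folklore] -/
theorem rateBlock3_eq {ℓ c L s X₀ X₁ X₂ X₃ A₁ A₂ κ Λ : ℝ} (hL : L ≠ 0) (hs : s ≠ 0) (hΛ : Λ ≠ 0) (hℓ : ℓ = c / L) :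
    ((Real.sqrt 2 * ℓ) ^ 3 * X₃ + 3 * (A₁ * ((Real.sqrt 2 * ℓ) ^ 2 * X₂)) + 3 * (A₂ * ((Real.sqrt 2 * ℓ) * X₁)) + κ * ℓ ^ 3 / Λ ^ 3 * X₀) /
        (4 / (s * L)) ^ 3 =
      s ^ 3 * ((Real.sqrt 2 * c) ^ 3 * X₃ + 3 * ((L * A₁) * ((Real.sqrt 2 * c) ^ 2 * X₂)) + 3 * ((L ^ 2 * A₂) * ((Real.sqrt 2 * c) * X₁)) +
        κ * c ^ 3 / Λ ^ 3 * X₀) / 64 := by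
  subst hℓ
  field_simp
  ring

/-- **Quadratic rate block**: with `ℓ = c/L`, `((√2ℓ)²X₂ + 2(A₁((√2ℓ)X₁)) + A₂X₀)/(4/(sL))² = s²·((√2c)²X₂ + 2((L·A₁)((√2c)X₁)) + (L²A₂)X₀)/16`. -/
theorem rateBlock2_eq {ℓ c L s X₀ X₁ X₂ A₁ A₂ : ℝ} (hL : L ≠ 0) (hs : s ≠ 0) (hℓ : ℓ = c / L) :
    ((Real.sqrt 2 * ℓ) ^ 2 * X₂ + 2 * (A₁ * ((Real.sqrt 2 * ℓ) * X₁)) + A₂ * X₀) / (4 / (s * L)) ^ 2 =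
      s ^ 2 * ((Real.sqrt 2 * c) ^ 2 * X₂ + 2 * ((L * A₁) * ((Real.sqrt 2 * c) * X₁)) + (L ^ 2 * A₂) * X₀) / 16 := by
  subst hℓ
  field_simp
  ring

/-! ## §3 The direction amplitudes carry `ℓ` resp. `ℓ²` -/

/-- **`L·A₁ ≤ a₁`** for the first-order direction amplitude `A₁ = 2G₁·u/Λ·1 + 1·1·(9(4Ba((1+2w)(2ℓ))))`, given `L·u ≤ U`, `L·ℓ ≤ cℓ`. [folklore] -/
theorem rateAmp1_mul_le {L u U ℓ cℓ G₁ Λ Ba w A₁ : ℝ} (hG₁ : 0 ≤ G₁) (hΛ : 0 < Λ) (hBa : 0 ≤ Ba) (hw : 0 ≤ w)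
    (hu : L * u ≤ U) (hℓ : L * ℓ ≤ cℓ) (hA₁ : A₁ = 2 * G₁ * u / Λ * 1 + 1 * 1 * (9 * (4 * Ba * ((1 + 2 * w) * (2 * ℓ))))) :
    L * A₁ ≤ 2 * G₁ * U / Λ + 9 * (4 * Ba * ((1 + 2 * w) * (2 * cℓ))) := by
  rw [hA₁]
  have e : L * (2 * G₁ * u / Λ * 1 + 1 * 1 * (9 * (4 * Ba * ((1 + 2 * w) * (2 * ℓ))))) =
      2 * G₁ * (L * u) / Λ + 9 * (4 * Ba * ((1 + 2 * w) * (2 * (L * ℓ)))) := by ring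
  rw [e]
  gcongr

/-- **`L²·A₂ ≤ a₂`** for the second-order direction amplitude (every term quadratic in `(u, ℓ)`), given `L·u ≤ U`, `L·ℓ ≤ cℓ`, `0 ≤ u, ℓ`. [folklore] -/
theorem rateAmp2_mul_le {L u U ℓ cℓ G₁ G₂ Λ Ba w Kp A₂ : ℝ} (hL : 0 ≤ L) (hG₁ : 0 ≤ G₁) (hG₂ : 0 ≤ G₂) (hΛ : 0 < Λ) (hBa : 0 ≤ Ba)
    (hw : 0 ≤ w) (hKp : 0 ≤ Kp) (hu0 : 0 ≤ u) (hℓ0 : 0 ≤ ℓ) (hu : L * u ≤ U) (hℓ : L * ℓ ≤ cℓ)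
    (hA₂ : A₂ = ((4 * G₂ + 2 * G₁) * u ^ 2 / Λ ^ 2 + 2 * G₁ * (Kp * ℓ ^ 2) / Λ) * 1 +
      4 * G₁ * u / Λ * (9 * (4 * Ba * ((1 + 2 * w) * (2 * ℓ)))) +
      1 * 1 * (9 * (4 * Ba * ((1 + 2 * w) * (2 * ℓ))) ^ 2 + 8 * Ba ^ 2 * ((1 + 2 * w) * (2 * ℓ)) ^ 2)) :
    L ^ 2 * A₂ ≤ (4 * G₂ + 2 * G₁) * U ^ 2 / Λ ^ 2 + 2 * G₁ * (Kp * cℓ ^ 2) / Λ +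
      4 * G₁ * U / Λ * (9 * (4 * Ba * ((1 + 2 * w) * (2 * cℓ)))) +
      (9 * (4 * Ba * ((1 + 2 * w) * (2 * cℓ))) ^ 2 + 8 * Ba ^ 2 * ((1 + 2 * w) * (2 * cℓ)) ^ 2) := by
  rw [hA₂]
  have hLu : 0 ≤ L * u := mul_nonneg hL hu0
  have hLℓ : 0 ≤ L * ℓ := mul_nonneg hL hℓ0
  have hU : 0 ≤ U := hLu.trans hu
  have e : L ^ 2 * (((4 * G₂ + 2 * G₁) * u ^ 2 / Λ ^ 2 + 2 * G₁ * (Kp * ℓ ^ 2) / Λ) * 1 +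
      4 * G₁ * u / Λ * (9 * (4 * Ba * ((1 + 2 * w) * (2 * ℓ)))) +
      1 * 1 * (9 * (4 * Ba * ((1 + 2 * w) * (2 * ℓ))) ^ 2 + 8 * Ba ^ 2 * ((1 + 2 * w) * (2 * ℓ)) ^ 2)) =
      (4 * G₂ + 2 * G₁) * (L * u) ^ 2 / Λ ^ 2 + 2 * G₁ * (Kp * (L * ℓ) ^ 2) / Λ +
      4 * G₁ * (L * u) / Λ * (9 * (4 * Ba * ((1 + 2 * w) * (2 * (L * ℓ))))) +
      (9 * (4 * Ba * ((1 + 2 * w) * (2 * (L * ℓ)))) ^ 2 + 8 * Ba ^ 2 * ((1 + 2 * w) * (2 * (L * ℓ))) ^ 2) := by ring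
  rw [e]
  gcongr

/-- The three direction scalars: `L·u_e ≤ (4+2A)(2π) + Kp(ρf+4π)(2π)`, `L·u_n ≤ (4+2A)(5π) + Kp(ρf+10π)(5π)`,
`L·u_v ≤ (2π)(4+2A) + Kp(ρf+10π)(5π)` at `ℓ₁ = 2π/L`, `ℓ = (2π/L)(2+½)`, `1 ≤ L`. [folklore] -/
theorem rateDir_mul_le {L A Kp ρf ℓ₁ ℓ : ℝ} (hL : 1 ≤ L) (hA : 0 ≤ A) (hKp : 0 ≤ Kp) (hρf : 0 ≤ ρf) (hℓ₁ : ℓ₁ = 2 * π / L)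
    (hℓ : ℓ = 2 * π / L * (2 + 1 / 2)) :
    L * ℓ₁ ≤ 2 * π ∧ L * ℓ ≤ 5 * π ∧ 0 ≤ ℓ₁ ∧ 0 ≤ ℓ ∧
    L * ((4 + 2 * A) * ℓ₁ + Kp * (ρf + 2 * ℓ₁) * ℓ₁) ≤ (4 + 2 * A) * (2 * π) + Kp * (ρf + 4 * π) * (2 * π) ∧
    L * ((4 + 2 * A) * ℓ + Kp * (ρf + 2 * ℓ) * ℓ) ≤ (4 + 2 * A) * (5 * π) + Kp * (ρf + 10 * π) * (5 * π) ∧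
    L * (|2 * π / L| * (4 + 2 * A) + Kp * (ρf + 2 * ℓ) * ℓ) ≤ (2 * π) * (4 + 2 * A) + Kp * (ρf + 10 * π) * (5 * π) ∧
    0 ≤ (4 + 2 * A) * ℓ₁ + Kp * (ρf + 2 * ℓ₁) * ℓ₁ ∧ 0 ≤ (4 + 2 * A) * ℓ + Kp * (ρf + 2 * ℓ) * ℓ ∧
    0 ≤ |2 * π / L| * (4 + 2 * A) + Kp * (ρf + 2 * ℓ) * ℓ := by
  have hL0 : 0 < L := by linarith
  have hπ := Real.pi_pos
  have e₁ : L * ℓ₁ = 2 * π := by rw [hℓ₁]; field_simp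
  have e₂ : L * ℓ = 5 * π := by rw [hℓ]; field_simp; ring
  have hℓ₁0 : 0 ≤ ℓ₁ := by rw [hℓ₁]; positivity
  have hℓ0 : 0 ≤ ℓ := by rw [hℓ]; positivity
  have hℓ₁le : ℓ₁ ≤ 2 * π := by
    rw [hℓ₁, div_le_iff₀ hL0]; nlinarith
  have hℓle : ℓ ≤ 5 * π := by
    rw [hℓ]; rw [div_mul_eq_mul_div, div_le_iff₀ hL0]; nlinarith
  have habs : |2 * π / L| = ℓ₁ := by rw [hℓ₁, abs_of_nonneg (by positivity)]
  refine ⟨e₁.le, e₂.le, hℓ₁0, hℓ0, ?_, ?_, ?_, by positivity, by positivity, by positivity⟩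
  · have e : L * ((4 + 2 * A) * ℓ₁ + Kp * (ρf + 2 * ℓ₁) * ℓ₁) = (4 + 2 * A) * (L * ℓ₁) + Kp * (ρf + 2 * ℓ₁) * (L * ℓ₁) := by ring
    rw [e, e₁]
    have : ρf + 2 * ℓ₁ ≤ ρf + 4 * π := by linarith
    gcongr
  · have e : L * ((4 + 2 * A) * ℓ + Kp * (ρf + 2 * ℓ) * ℓ) = (4 + 2 * A) * (L * ℓ) + Kp * (ρf + 2 * ℓ) * (L * ℓ) := by ring
    rw [e, e₂]
    have : ρf + 2 * ℓ ≤ ρf + 10 * π := by linarith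
    gcongr
  · have e : L * (|2 * π / L| * (4 + 2 * A) + Kp * (ρf + 2 * ℓ) * ℓ) = (L * ℓ₁) * (4 + 2 * A) + Kp * (ρf + 2 * ℓ) * (L * ℓ) := by
      rw [habs]; ring
    rw [e, e₁, e₂]
    have : ρf + 2 * ℓ ≤ ρf + 10 * π := by linarith
    gcongr

/-! ## §4 The counting factor at the canonical rates -/

/-- **`√W(1/(2M))·√(24·2M·L²·N̄_L) ≤ (2M+1)·L²·√(24·W₁·N₁)`** (`N̄_L ≤ L²·N₁` for `L ≥ 1`, `2M·(2M+1) ≤ (2M+1)²`;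
`W₁ = 524288·((1+4√2)²(2√2+2)² + 4)`). [folklore] -/
theorem sliceDefect_count_le {Lr M₂ Λm β r₁ r₂ : ℝ} (hL : 1 ≤ Lr) (hM : 1 ≤ M₂) (hΛm : 0 ≤ Λm) (hβ : 0 ≤ β) (hr₁ : 0 ≤ r₁) (hr₂ : 0 ≤ r₂) :
    Real.sqrt (524288 * (1 / (1 / M₂) + 1) *
          ((1 + 2 * Real.sqrt 2 * 1 / (1 * (2 - 1)) + 2 * Real.sqrt 2 * 1 / (1 * (2 - 1))) ^ 2 *
            ((2 * Real.sqrt 2 / (1 * (2 - 1)) + 2) * (2 * Real.sqrt 2 / (1 * (2 - 1)) + 2))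
            + (1 / 1 + 1) ^ 2 / (1 + 1 * ((0 : ℕ) : ℝ)))) *
        Real.sqrt (24 * M₂ * Lr ^ 2 * ((Λm * β / π + 1) * ((Real.sqrt 2 * Lr * r₁ / π + 2) * (Real.sqrt 2 * Lr * r₂ / π + 2)))) ≤
      (M₂ + 1) * Lr ^ 2 * Real.sqrt (24 * (524288 * ((1 + 4 * Real.sqrt 2) ^ 2 * (2 * Real.sqrt 2 + 2) ^ 2 + 4)) *
        ((Λm * β / π + 1) * ((Real.sqrt 2 * r₁ / π + 2) * (Real.sqrt 2 * r₂ / π + 2)))) := by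
  have hM0 : 0 < M₂ := by linarith
  have hπ := Real.pi_pos
  -- simplify the rate numerals
  have e₁ : (1 + 2 * Real.sqrt 2 * 1 / (1 * (2 - 1)) + 2 * Real.sqrt 2 * 1 / (1 * (2 - 1))) ^ 2 *
      ((2 * Real.sqrt 2 / (1 * (2 - 1)) + 2) * (2 * Real.sqrt 2 / (1 * (2 - 1)) + 2)) + (1 / 1 + 1) ^ 2 / (1 + 1 * ((0 : ℕ) : ℝ)) =
      (1 + 4 * Real.sqrt 2) ^ 2 * (2 * Real.sqrt 2 + 2) ^ 2 + 4 := by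
    push_cast; ring
  have e₃ : 1 / (1 / M₂) + 1 = M₂ + 1 := by rw [one_div_one_div]
  rw [e₁, e₃]
  set w₁ : ℝ := (1 + 4 * Real.sqrt 2) ^ 2 * (2 * Real.sqrt 2 + 2) ^ 2 + 4 with hw₁
  set N₁ : ℝ := (Λm * β / π + 1) * ((Real.sqrt 2 * r₁ / π + 2) * (Real.sqrt 2 * r₂ / π + 2)) with hN₁
  set Nb : ℝ := (Λm * β / π + 1) * ((Real.sqrt 2 * Lr * r₁ / π + 2) * (Real.sqrt 2 * Lr * r₂ / π + 2)) with hNb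
  have hw₁0 : 0 ≤ w₁ := by rw [hw₁]; positivity
  have hN₁0 : 0 ≤ N₁ := by rw [hN₁]; positivity
  have hNb0 : 0 ≤ Nb := by rw [hNb]; positivity
  have hf : ∀ X : ℝ, 0 ≤ X → Real.sqrt 2 * Lr * X / π + 2 ≤ Lr * (Real.sqrt 2 * X / π + 2) := by
    intro X hX
    have h : Lr * (Real.sqrt 2 * X / π + 2) - (Real.sqrt 2 * Lr * X / π + 2) = 2 * (Lr - 1) := by ring
    linarith
  have hNb_le : Nb ≤ Lr ^ 2 * N₁ := by
    rw [hNb, hN₁]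
    have h1 := hf r₁ hr₁
    have h2 := hf r₂ hr₂
    calc (Λm * β / π + 1) * ((Real.sqrt 2 * Lr * r₁ / π + 2) * (Real.sqrt 2 * Lr * r₂ / π + 2))
        ≤ (Λm * β / π + 1) * ((Lr * (Real.sqrt 2 * r₁ / π + 2)) * (Lr * (Real.sqrt 2 * r₂ / π + 2))) := by gcongr
      _ = Lr ^ 2 * ((Λm * β / π + 1) * ((Real.sqrt 2 * r₁ / π + 2) * (Real.sqrt 2 * r₂ / π + 2))) := by ring
  clear_value w₁ N₁ Nb
  have hQ : 0 ≤ (M₂ + 1) * Lr ^ 2 * Real.sqrt (24 * (524288 * w₁) * N₁) := by positivity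
  rw [← Real.sqrt_mul (by positivity), ← Real.sqrt_sq hQ]
  apply Real.sqrt_le_sqrt
  rw [mul_pow, mul_pow, Real.sq_sqrt (by positivity)]
  have h1 : 24 * M₂ * Lr ^ 2 * Nb ≤ 24 * (M₂ + 1) * Lr ^ 2 * (Lr ^ 2 * N₁) := by
    have : 24 * M₂ * Lr ^ 2 * Nb ≤ 24 * M₂ * Lr ^ 2 * (Lr ^ 2 * N₁) := mul_le_mul_of_nonneg_left hNb_le (by positivity)
    nlinarith [this, mul_nonneg (by positivity : (0:ℝ) ≤ 24 * Lr ^ 2 * (Lr ^ 2 * N₁)) hM0.le]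
  calc 524288 * (M₂ + 1) * w₁ * (24 * M₂ * Lr ^ 2 * Nb)
      ≤ 524288 * (M₂ + 1) * w₁ * (24 * (M₂ + 1) * Lr ^ 2 * (Lr ^ 2 * N₁)) := mul_le_mul_of_nonneg_left h1 (by positivity)
    _ = (M₂ + 1) ^ 2 * (Lr ^ 2) ^ 2 * (24 * (524288 * w₁) * N₁) := by ring


end Summit.HubbardSuperconductivity.HubbardSuperconductivity.Theorems.TorusFourierL2

end
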